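import Literature.MathematicalPhysics.QuantumFieldTheory.Balaban1983to89.B9B8KnitBondResolvent
import Literature.MathematicalPhysics.QuantumFieldTheory.Balaban1983to89.B8Ineq159AtLettersY

/-!
# `Balaban1983to89.B9B8KnitBondBootstrap` — THE BOND-SECTOR KNIT∕TAXICAB JUNCTION, FILE 3: the WEIGHTED BOOTSTRAP of [Balaban1985BackgroundPropagators] (3.106) ∕
# Thm 3.11 («G = G₀(I − R)⁻¹, R is an operator with small norm») in the (3.41) norms — `Δ₂` a unit with the three (3.47)_{γ=−3} members for `Δ₂⁻¹` at `B₀` and a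
# perturbation `E` with `|EA|₍₋₃₎ ≤ κ·S(A)`, `2(d+3)B₀κ ≤ 1` ⇒ `Δ₂ + E` a unit with the members at `2B₀`; hence the FOUR Δ_a-side members of the [B8] Thm 2 torus
# binder TRANSFER from one site-transporter letter to another given the junction inequality on `D_U(P₂ − P₁)D*_U`

statement-level skeleton of published theorems with citation tags; proofs where landed; nothing here is a claim about the Yang–Mills mass gap

T. Bałaban, *Propagators for lattice gauge theories in a background field*, Commun. Math. Phys. **99** (1985) 389–434 [`Balaban1985BackgroundPropagators`, "[B9]"]
(PDF held: `paper:balaban1985-cmp99-background-propagators`, journal page = PDF page + 388): (3.41) p. 397 (the weighted norms `|·|₍γ₎`), (3.47) p. 398, (3.106) p. 414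
«For M sufficiently large this implies G = G₀(I − R)⁻¹ = Σ G₀Rⁿ», Thm 3.11 p. 416 «It is a symmetric and invertible operator … R is an operator with small norm … This
is in contradiction with the inequality ⟨A,(I − R*)A⟩ = ⟨A,A⟩ − Re⟨A,RA⟩ ≥ (1 − O(M⁻¹))⟨A,A⟩ > 0», (3.25)–(3.27) p. 395, (3.101) p. 414.  [4] = T. Bałaban, *Propagators and
renormalization transformations for lattice gauge theories. II*, Commun. Math. Phys. **96** (1984) 223–250 [`Balaban1984PropagatorsII`]: (2.50) p. 232, (2.66) p. 234.
T. Bałaban, *Spaces of regular gauge field configurations …*, CMP **99** (1985) 75–102 [`Balaban1985RegularSpaces`]: (1.59)–(1.60) pp. 86–87 (the same bootstrap: «B₀36dα₂ ≦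
1∕2 … multiplied by 2»), Thm 2 p. 83.  Rows B9.Eq3.106 × B9.Thm3.11 × B8.Eq1.59 (cells only; no row head changes).

WHY THIS FILE (lead g34 RULING JUNCTION-PARS (T) CONFIRMED 2026-08-28T23:20Z; design memo `pub/lit-balaban/lit-balaban-t2s-1/g10/JB-BOND-DESIGN.md` v2, FILE 3).  FILE 1
(`B9B8KnitBondResolvent`) reduced the bond-sector junction to ONE perturbation `E = Δ_a(U; parKnitY) − Δ_a(U; parSymY) = D_U(P_sym − P_knit)D*_U` and gave the
resolvent ∕ member ∕ invertibility identities.  THIS FILE is the analytic-free half of the transfer: r05's (1.59)–(1.60) bootstrap pattern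
(`B8Ineq159AtLettersY.ineq159_three_atLettersY`) run for an abstract perturbation.  If `G₂ = Δ₂⁻¹` obeys `|G₂Y|₍₋₁₎, |∇_{U,ν}G₂Y|₍₋₂₎, |Δ_U G₂Y|₍₋₃₎ ≤ B₀|Y|₍₋₃₎` and
`|EA|₍₋₃₎ ≤ κ·S(A)` with `S(A) = |A|₍₋₁₎ + Σ_ν|∇_{U,ν}A|₍₋₂₎ + |Δ_U A|₍₋₃₎`, then every `A` with `(Δ₂ + E)A = F` has `A = G₂(F − EA)`, so `S(A) ≤ (d+3)B₀(|F|₍₋₃₎ + κS(A))`,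
whence `S(A) ≤ 2(d+3)B₀|F|₍₋₃₎` under `2(d+3)B₀κ ≤ 1` and each member is `≤ 2B₀|F|₍₋₃₎`; with `F = 0` the kernel of `Δ₂ + E` is trivial (the weighted norm is a norm: every
weight `(Lʲ|c_f|⁻¹)^{−γ}` is positive), so `Δ₂ + E` is a unit on the finite carrier (FILE 1 `isUnit_of_forall_eq_zero`).  At the letters this is exactly: the FOUR Δ_a-side
members of the [B8] Thm 2 torus binder (`B8Thm2TorusCoverOfProp6DeltaAFour`) at `parS₁` from the four at `parS₂` plus the junction inequality — FILE 2's target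
`|(D_U P₂ D*_U − D_U P₁ D*_U)A|₍₋₃₎ ≤ κ|A|₍₋₁₎` (p38) or the weaker `κ·S(A)` shape.

WHAT IS PROVED (all `theorem`s; 0 `def`, 0 `… : Prop` fact, 0 sorry; any coefficient algebra `𝔸`, `[FiniteDimensional ℂ 𝔸]` where a kernel argument is used).
* §1 `wNormBY_neg_le`, `wNormBY_sub_le`, `wNormBY_zero`, ★ `eq_zero_of_wNormBY_le_zero` (the (3.41) norm is a norm).
* §2 `functional_nonneg`; ★ `apriori` (the a priori estimate for `A = G₂(F − EA)`: `S(A) ≤ 2(d+3)B₀|F|₍₋₃₎` and the three members `≤ 2B₀|F|₍₋₃₎`); ★★ `bootstrap`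
  (`Δ₂` a unit + members for `Ring.inverse Δ₂` at `B₀` + `|EA|₍₋₃₎ ≤ κS(A)` + `2(d+3)B₀κ ≤ 1` ⇒ `IsUnit (Δ₂ + E)` and the members for `Ring.inverse (Δ₂ + E)` at `2B₀`).
* §3 ★★★ `deltaAFour_transfer` (at the letters: `IsUnit Δ_a(U; parS₂)` + members of `G_a(U; parS₂)` at `B₀` + `|D_U((R₁ − R₂)(D*_U A))|₍₋₃₎ ≤ κS(A)` ⇒ `IsUnit Δ_a(U; parS₁)` +
  members of `G_a(U; parS₁)` at `2B₀`), ★★★ `deltaAFour_transfer'` (the same from FILE 2's pure shape `|(DPDsY parS₂ G′₂ U − DPDsY parS₁ G′₁ U)A|₍₋₃₎ ≤ κ|A|₍₋₁₎`).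

HONEST SCOPE ∕ NOT CLAIMED.  Functional bookkeeping on the finite carrier: NO estimate of [B9]∕[4]∕[B8] is proved; the junction inequality (FILE 2, p38) and the four
members at `parSymY` (M5.7 + G7 §5) are DISPLAYED hypotheses of §3; constants doubled (`2B₀`), window `2(d+3)B₀κ ≤ 1` (print's «multiplied by 2»); nothing landed is
modified; count-neutral; no summit ∕ sub-problem statement proved; NOT a node discharge; `stub_PV3A` NOT discharged; nothing continuum ∕ ℝ⁴ ∕ OS ∕ mass-gap ∕ Clay —
the Yang–Mills mass gap is NOT proved by any of this.  No `sorry`, no `axiom`, no `def`, no `instance`, no `notation`.  NEW file.  RELATED, NOT DUPLICATED (searched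
2026-08-28: `lean search 'wNormBY_neg|wNormBY_sub_le|wNormBY_zero|deltaAFour_transfer|eq_zero_of_wNormBY' --decl`): r05's §1 toolkit of `B8Ineq159AtLettersY` (USED:
`wNormBY_add_le`, `weight_mul_norm_le_wNormBY`, `wNormBY_le_of_weight_mul_norm_le`), g8's `B9B8KnitClosenessOfSectors.wNormBY_neg` (the equality `|−Ψ| = |Ψ|` in the
knit cone — here only `≤` is needed, proved in two lines without that import), `B9B8KnitNormsTransfer.weight_level_pos` (same positivity, re-derived in one line from
`B8ScaledSupNorm.weight_pos` to keep the import cone small).  Cell `lit-balaban`, seat `lit-balaban-t2s-1` gen 10, 2026-08-28; `--supports stmt-QuantumFields-19200`.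
-/

noncomputable section

open scoped BigOperators

namespace Literature.MathematicalPhysics.QuantumFieldTheory.Balaban1983to89.B9B8KnitBondBootstrap

open Node00
open B6KLevelCensusIndexV1 (KIdx)
open B6GlobalChartV1 (blkV1)
open B8ScaledSupNorm (weight weight_pos weight_nonneg)
open B8Ineq159AtLettersY (wNormBY_nonneg wNormBY_add_le weight_mul_norm_le_wNormBY wNormBY_le_of_weight_mul_norm_le)
open B9B8KnitBondResolvent (deltaAY_sub_deltaAY gradY_RY_sub_divY_eq isUnit_of_forall_eq_zero)
open B9Eq3104CutoffCommutators (DPDsY)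

variable {d ℓ : ℕ} {hd : 1 ≤ d + 1} {hL : Odd (ℓ + 1) ∧ 1 < ℓ + 1} {b₀ b₁ : ℝ}
variable {𝔸 : Type} [NormedRing 𝔸] [NormedAlgebra ℂ 𝔸] [CompleteSpace 𝔸]
variable (i : KIdx d ℓ hd hL b₀ b₁)

/-! ## §1 Three more facts about the weighted norm `|Ψ|₍α₎ = wNormBY i α Ψ`: `|−Ψ| = |Ψ|`, `|Ψ − Φ| ≤ |Ψ| + |Φ|`, `|0| = 0`, and `|Ψ|₍α₎ = 0 ⇒ Ψ = 0` -/

section Norm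

omit [NormedAlgebra ℂ 𝔸] [CompleteSpace 𝔸] in
/-- `|−Ψ|₍α₎ ≤ |Ψ|₍α₎` (hence equality). [cite: Balaban1985RegularSpaces, p.86 (definition after (1.55)); Balaban1985BackgroundPropagators, (3.41) p.397] -/
theorem wNormBY_neg_le (α : ℝ) (Ψ : FBondY i → 𝔸) : wNormBY i α (-Ψ) ≤ wNormBY i α Ψ :=
  wNormBY_le_of_weight_mul_norm_le i (wNormBY_nonneg i α Ψ) fun x => by
    rw [Pi.neg_apply, norm_neg]; exact weight_mul_norm_le_wNormBY i α Ψ x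

omit [NormedAlgebra ℂ 𝔸] [CompleteSpace 𝔸] in
/-- `|Ψ − Φ|₍α₎ ≤ |Ψ|₍α₎ + |Φ|₍α₎`. [cite: Balaban1985RegularSpaces, (1.59) p.86] -/
theorem wNormBY_sub_le (α : ℝ) (Ψ Φ : FBondY i → 𝔸) : wNormBY i α (Ψ - Φ) ≤ wNormBY i α Ψ + wNormBY i α Φ := by
  rw [sub_eq_add_neg]
  exact (wNormBY_add_le i α Ψ (-Φ)).trans (by linarith [wNormBY_neg_le i α Φ])

omit [NormedAlgebra ℂ 𝔸] [CompleteSpace 𝔸] in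
/-- `|0|₍α₎ = 0`. [cite: Balaban1985RegularSpaces, p.86 (definition after (1.55))] -/
theorem wNormBY_zero (α : ℝ) : wNormBY i α (0 : FBondY i → 𝔸) = 0 :=
  le_antisymm (wNormBY_le_of_weight_mul_norm_le i le_rfl fun x => by simp) (wNormBY_nonneg i α _)

omit [NormedAlgebra ℂ 𝔸] [CompleteSpace 𝔸] in
/-- **the weighted norm is a norm**: `|Ψ|₍α₎ ≤ 0 ⇒ Ψ = 0` (every weight `(Lʲ|c_f|⁻¹)^{−α}` is positive, `c_f ≠ 0`).
[cite: Balaban1985RegularSpaces, p.86 (definition after (1.55)); Balaban1985BackgroundPropagators, (3.41) p.397] -/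
theorem eq_zero_of_wNormBY_le_zero {α : ℝ} {Ψ : FBondY i → 𝔸} (h : wNormBY i α Ψ ≤ 0) : Ψ = 0 := by
  funext x
  have hw : 0 < weight (ℓ + 1) |i.cf|⁻¹ α (blkV1 i.hN i.D x).1.1 :=
    weight_pos (Nat.succ_le_succ (Nat.zero_le ℓ)) (inv_pos.2 (abs_pos.2 i.hcf)) α _
  have h1 := (weight_mul_norm_le_wNormBY i α Ψ x).trans h
  have h2 : ‖Ψ x‖ ≤ 0 := by
    by_contra hc
    exact absurd h1 (not_le.2 (mul_pos hw (not_le.1 hc)))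
  exact norm_le_zero_iff.1 h2

end Norm

/-! ## §2 ★★ The abstract bootstrap: members for `G₂ = Δ₂⁻¹` at `B₀` + a weighted bound `κ` on the perturbation `E` ⇒ `Δ₂ + E` a unit with members at `2B₀` -/

section Bootstrap

variable (U : CfgY 𝔸 i)

/-- the bootstrap functional `S(A) = |A|₍₋₁₎ + Σ_ν |∇_{U,ν}A|₍₋₂₎ + |Δ_U A|₍₋₃₎` is non-negative. [cite: Balaban1985RegularSpaces, (1.59) p.86, bookkeeping] -/
theorem functional_nonneg (A : FBondY i → 𝔸) :
    0 ≤ wNormBY i (-1) A + ∑ ν : Fin (d + 1), wNormBY i (-2) (cdB i U ν A) + wNormBY i (-3) (lapB i U A) :=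
  add_nonneg (add_nonneg (wNormBY_nonneg i _ _) (Finset.sum_nonneg fun _ _ => wNormBY_nonneg i _ _)) (wNormBY_nonneg i _ _)

/-- ★ **THE A PRIORI ESTIMATE** (print's (1.59)–(1.60) ∕ (3.106) device in the weighted sup norms (3.41)): let `G₂` satisfy the three (3.47)_{γ=−3}-shape bounds
`|G₂Y|₍₋₁₎, |∇_{U,ν}G₂Y|₍₋₂₎, |Δ_U G₂Y|₍₋₃₎ ≤ B₀|Y|₍₋₃₎` and `E` the weighted bound `|EA|₍₋₃₎ ≤ κ·S(A)`, `S(A) = |A|₍₋₁₎ + Σ_ν|∇_{U,ν}A|₍₋₂₎ + |Δ_U A|₍₋₃₎`, with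
`2(d+3)B₀κ ≤ 1`.  If `A = G₂(F − EA)` then `S(A) ≤ 2(d+3)B₀|F|₍₋₃₎` and `|A|₍₋₁₎, |∇_{U,ν}A|₍₋₂₎, |Δ_U A|₍₋₃₎ ≤ 2B₀|F|₍₋₃₎`.
[cite: Balaban1985RegularSpaces, (1.59)–(1.60) pp.86–87; Balaban1985BackgroundPropagators, (3.106) p.414, (3.47) p.398, (3.41) p.397] -/
theorem apriori (G₂ E : Module.End ℂ (FBondY i → 𝔸)) {B₀ κ : ℝ} (hB₀ : 0 ≤ B₀) (hκ : 0 ≤ κ)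
    (hθ : 2 * (((d : ℝ) + 3) * B₀ * κ) ≤ 1)
    (hG0 : ∀ Y, wNormBY i (-1) (G₂ Y) ≤ B₀ * wNormBY i (-3) Y)
    (hG1 : ∀ Y ν, wNormBY i (-2) (cdB i U ν (G₂ Y)) ≤ B₀ * wNormBY i (-3) Y)
    (hG3 : ∀ Y, wNormBY i (-3) (lapB i U (G₂ Y)) ≤ B₀ * wNormBY i (-3) Y)
    (hE : ∀ A, wNormBY i (-3) (E A) ≤ κ * (wNormBY i (-1) A + ∑ ν : Fin (d + 1), wNormBY i (-2) (cdB i U ν A) + wNormBY i (-3) (lapB i U A)))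
    {A F : FBondY i → 𝔸} (hA : A = G₂ (F - E A)) :
    (wNormBY i (-1) A + ∑ ν : Fin (d + 1), wNormBY i (-2) (cdB i U ν A) + wNormBY i (-3) (lapB i U A) ≤
        2 * (((d : ℝ) + 3) * B₀) * wNormBY i (-3) F) ∧
    wNormBY i (-1) A ≤ 2 * B₀ * wNormBY i (-3) F ∧ (∀ ν, wNormBY i (-2) (cdB i U ν A) ≤ 2 * B₀ * wNormBY i (-3) F) ∧
    wNormBY i (-3) (lapB i U A) ≤ 2 * B₀ * wNormBY i (-3) F := by
  set S : ℝ := wNormBY i (-1) A + ∑ ν : Fin (d + 1), wNormBY i (-2) (cdB i U ν A) + wNormBY i (-3) (lapB i U A) with hS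
  set f : ℝ := wNormBY i (-3) F with hf
  set y : ℝ := wNormBY i (-3) (F - E A) with hy
  have hS0 : 0 ≤ S := functional_nonneg i U A
  have hf0 : 0 ≤ f := wNormBY_nonneg i _ _
  -- the perturbed source
  have hy1 : y ≤ f + κ * S := (wNormBY_sub_le i (-3) F (E A)).trans (by linarith [hE A])
  -- the three members of `G₂` at the perturbed source
  have h0 : wNormBY i (-1) A ≤ B₀ * y := by rw [hA]; exact hG0 _
  have h1 : ∀ ν, wNormBY i (-2) (cdB i U ν A) ≤ B₀ * y := fun ν => by rw [hA]; exact hG1 _ ν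
  have h3 : wNormBY i (-3) (lapB i U A) ≤ B₀ * y := by rw [hA]; exact hG3 _
  have hsum : ∑ ν : Fin (d + 1), wNormBY i (-2) (cdB i U ν A) ≤ ((d : ℝ) + 1) * (B₀ * y) := by
    have := Finset.sum_le_sum fun ν (_ : ν ∈ (Finset.univ : Finset (Fin (d + 1)))) => h1 ν
    simpa [Finset.sum_const, Finset.card_univ, Fintype.card_fin, nsmul_eq_mul] using this
  -- the bootstrap: `S ≤ (d+3)B₀(f + κS)` and `(d+3)B₀κ ≤ 1∕2`
  have hS1 : S ≤ ((d : ℝ) + 3) * B₀ * (f + κ * S) := by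
    have hB₀y : B₀ * y ≤ B₀ * (f + κ * S) := mul_le_mul_of_nonneg_left hy1 hB₀
    have : S ≤ ((d : ℝ) + 3) * (B₀ * y) := by rw [hS]; nlinarith [h0, h3, hsum]
    nlinarith [this, hB₀y, (by positivity : (0 : ℝ) ≤ (d : ℝ) + 3)]
  have hS2 : S ≤ 2 * (((d : ℝ) + 3) * B₀) * f := by nlinarith [hS1, hθ, hS0, hf0, hB₀, hκ]
  -- each member: `≤ B₀(f + κS) ≤ B₀f(1 + 2(d+3)B₀κ) ≤ 2B₀f`
  have hmem : B₀ * y ≤ 2 * B₀ * f := by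
    have h5 : B₀ * y ≤ B₀ * (f + κ * S) := mul_le_mul_of_nonneg_left hy1 hB₀
    have h6 : κ * S ≤ κ * (2 * (((d : ℝ) + 3) * B₀) * f) := mul_le_mul_of_nonneg_left hS2 hκ
    have h7 : κ * (2 * (((d : ℝ) + 3) * B₀) * f) ≤ f := by
      have : κ * (2 * (((d : ℝ) + 3) * B₀)) ≤ 1 := by nlinarith [hθ]
      nlinarith [this, hf0]
    nlinarith [h5, h6, h7, hB₀]
  exact ⟨hS2, h0.trans hmem, fun ν => (h1 ν).trans hmem, h3.trans hmem⟩

/-- ★★ **THE ABSTRACT BOOTSTRAP** — print's «G = G₀(I − R)⁻¹, R is an operator with small norm» in the weighted sup norms: on the finite bond carrier, `Δ₂` a unit whose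
inverse `G₂` has the three (3.47)_{γ=−3}-shape members at `B₀`, `E` with `|EA|₍₋₃₎ ≤ κ·S(A)` and `2(d+3)B₀κ ≤ 1` ⇒ `Δ₂ + E` is a unit and its inverse has the three
members at `2B₀`. [cite: Balaban1985BackgroundPropagators, (3.106) p.414, Thm 3.11 p.416, (3.47) p.398; Balaban1985RegularSpaces, (1.59)–(1.60) pp.86–87; Balaban1984PropagatorsII, (2.66) p.234] -/
theorem bootstrap [FiniteDimensional ℂ 𝔸] (Δ₂ E : Module.End ℂ (FBondY i → 𝔸)) (h₂ : IsUnit Δ₂) {B₀ κ : ℝ} (hB₀ : 0 ≤ B₀) (hκ : 0 ≤ κ)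
    (hθ : 2 * (((d : ℝ) + 3) * B₀ * κ) ≤ 1)
    (hG0 : ∀ Y, wNormBY i (-1) (Ring.inverse Δ₂ Y) ≤ B₀ * wNormBY i (-3) Y)
    (hG1 : ∀ Y ν, wNormBY i (-2) (cdB i U ν (Ring.inverse Δ₂ Y)) ≤ B₀ * wNormBY i (-3) Y)
    (hG3 : ∀ Y, wNormBY i (-3) (lapB i U (Ring.inverse Δ₂ Y)) ≤ B₀ * wNormBY i (-3) Y)
    (hE : ∀ A, wNormBY i (-3) (E A) ≤ κ * (wNormBY i (-1) A + ∑ ν : Fin (d + 1), wNormBY i (-2) (cdB i U ν A) + wNormBY i (-3) (lapB i U A))) :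
    IsUnit (Δ₂ + E) ∧
    (∀ F, wNormBY i (-1) (Ring.inverse (Δ₂ + E) F) ≤ 2 * B₀ * wNormBY i (-3) F) ∧
    (∀ F ν, wNormBY i (-2) (cdB i U ν (Ring.inverse (Δ₂ + E) F)) ≤ 2 * B₀ * wNormBY i (-3) F) ∧
    (∀ F, wNormBY i (-3) (lapB i U (Ring.inverse (Δ₂ + E) F)) ≤ 2 * B₀ * wNormBY i (-3) F) := by
  -- `G₂Δ₂ = 1`
  have hGΔ : ∀ A, Ring.inverse Δ₂ (Δ₂ A) = A := fun A => by
    rw [← Module.End.mul_apply, Ring.inverse_mul_cancel _ h₂, Module.End.one_apply]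
  -- every `A` with `(Δ₂ + E)A = F` has the form `A = G₂(F − EA)`
  have hform : ∀ A F, (Δ₂ + E) A = F → A = Ring.inverse Δ₂ (F - E A) := fun A F h => by
    have h' : Δ₂ A = F - E A := by rw [LinearMap.add_apply] at h; rw [← h]; abel
    rw [← h', hGΔ]
  -- the kernel is trivial
  have hU : IsUnit (Δ₂ + E) := by
    refine isUnit_of_forall_eq_zero i fun A hA => ?_
    have hc := (apriori i U (Ring.inverse Δ₂) E hB₀ hκ hθ hG0 hG1 hG3 hE (hform A 0 hA)).2.1
    rw [wNormBY_zero, mul_zero] at hc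
    exact eq_zero_of_wNormBY_le_zero i hc
  -- the members at the solution `A = (Δ₂ + E)⁻¹F`
  have hsol : ∀ F, (Δ₂ + E) (Ring.inverse (Δ₂ + E) F) = F := fun F => by
    rw [← Module.End.mul_apply, Ring.mul_inverse_cancel _ hU, Module.End.one_apply]
  refine ⟨hU, fun F => ?_, fun F ν => ?_, fun F => ?_⟩
  · exact (apriori i U (Ring.inverse Δ₂) E hB₀ hκ hθ hG0 hG1 hG3 hE (hform _ F (hsol F))).2.1
  · exact (apriori i U (Ring.inverse Δ₂) E hB₀ hκ hθ hG0 hG1 hG3 hE (hform _ F (hsol F))).2.2.1 ν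
  · exact (apriori i U (Ring.inverse Δ₂) E hB₀ hκ hθ hG0 hG1 hG3 hE (hform _ F (hsol F))).2.2.2

end Bootstrap

/-! ## §3 ★★★ At the letters: the four Δ_a-side members at `parS₁` from those at `parS₂` and the weighted bound on `D_U(R₁ − R₂)D*_U` -/

section Letters

/-- ★★★ **THE FOUR Δ_a-SIDE MEMBERS TRANSFER BETWEEN TWO SITE-TRANSPORTER LETTERS.**  At one background `U`, one `parB`, two pairs `(parS₁, G′₁)`, `(parS₂, G′₂)`: if
`Δ_a(U; parS₂)` is a unit and `G_a(U; parS₂)` has the three weighted members at `B₀` (the (Δa) binder of the [B8] Thm 2 torus supplier at `parS₂`), and the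
projection difference obeys `|D_U((R₁ − R₂)(D*_U A))|₍₋₃₎ ≤ κ·(|A|₍₋₁₎ + Σ_ν|∇_{U,ν}A|₍₋₂₎ + |Δ_U A|₍₋₃₎)` with `2(d+3)B₀κ ≤ 1`, then `Δ_a(U; parS₁)` is a unit and
`G_a(U; parS₁)` has the three members at `2B₀` — the four-member binder at `parS₁`.  (For the sub-row: `parS₁ := parKnitY i`, `parS₂ := parSymY i`, `κ` from
junction J-B.)  [cite: Balaban1985BackgroundPropagators, (3.25)–(3.27) p.395, (3.106) p.414, Thm 3.11 p.416, (3.47) p.398, (3.69) p.404; Balaban1984PropagatorsII, (2.50) p.232, (2.66) p.234; Balaban1985RegularSpaces, Thm 2 p.83, (1.58)–(1.60) pp.86–87] -/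
theorem deltaAFour_transfer [FiniteDimensional ℂ 𝔸] (parS₁ parS₂ : SiteParY 𝔸 i) (parB : BondParY 𝔸 i) (Gp₁ Gp₂ : SiteOpY 𝔸 i) (U : CfgY 𝔸 i)
    {B₀ κ : ℝ} (hB₀ : 0 ≤ B₀) (hκ : 0 ≤ κ) (hθ : 2 * (((d : ℝ) + 3) * B₀ * κ) ≤ 1)
    (h₂ : IsUnit (deltaAY i parS₂ parB Gp₂ U))
    (hG0 : ∀ F, wNormBY i (-1) (GAY i parS₂ parB Gp₂ U F) ≤ B₀ * wNormBY i (-3) F)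
    (hG1 : ∀ F ν, wNormBY i (-2) (cdB i U ν (GAY i parS₂ parB Gp₂ U F)) ≤ B₀ * wNormBY i (-3) F)
    (hG3 : ∀ F, wNormBY i (-3) (lapB i U (GAY i parS₂ parB Gp₂ U F)) ≤ B₀ * wNormBY i (-3) F)
    (hE : ∀ A, wNormBY i (-3) (gradY i U ((RY i parS₁ Gp₁ U - RY i parS₂ Gp₂ U) (divY i U A))) ≤
      κ * (wNormBY i (-1) A + ∑ ν : Fin (d + 1), wNormBY i (-2) (cdB i U ν A) + wNormBY i (-3) (lapB i U A))) :
    IsUnit (deltaAY i parS₁ parB Gp₁ U) ∧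
    (∀ F, wNormBY i (-1) (GAY i parS₁ parB Gp₁ U F) ≤ 2 * B₀ * wNormBY i (-3) F) ∧
    (∀ F ν, wNormBY i (-2) (cdB i U ν (GAY i parS₁ parB Gp₁ U F)) ≤ 2 * B₀ * wNormBY i (-3) F) ∧
    (∀ F, wNormBY i (-3) (lapB i U (GAY i parS₁ parB Gp₁ U F)) ≤ 2 * B₀ * wNormBY i (-3) F) := by
  have hΔ : deltaAY i parS₁ parB Gp₁ U = deltaAY i parS₂ parB Gp₂ U + gradY i U ∘ₗ (RY i parS₁ Gp₁ U - RY i parS₂ Gp₂ U) ∘ₗ divY i U := by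
    rw [← deltaAY_sub_deltaAY]; abel
  have h := bootstrap i U (deltaAY i parS₂ parB Gp₂ U) (gradY i U ∘ₗ (RY i parS₁ Gp₁ U - RY i parS₂ Gp₂ U) ∘ₗ divY i U) h₂ hB₀ hκ hθ
    hG0 hG1 hG3 (fun A => by simpa only [LinearMap.comp_apply] using hE A)
  rw [← hΔ] at h
  exact h

/-- ★★★ **THE SAME WITH THE PURE SHAPE `|D_U P_s D*_U A − D_U P_k D*_U A|₍₋₃₎ ≤ κ|A|₍₋₁₎`** of the junction's estimate file (design memo FILE 2): the
perturbation spelled with b11's (3.101) letter `DPDsY parS Gp U = gradY ∘ (1 − RY parS Gp) ∘ divY`, the bound on the right by `|A|₍₋₁₎` alone (the other two terms of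
`S(A)` are non-negative). [cite: Balaban1985BackgroundPropagators, (3.101) p.414, (3.106) p.414, (3.25)–(3.27) p.395, Thm 3.11 p.416; Balaban1984PropagatorsII, (2.50) p.232, (2.66) p.234] -/
theorem deltaAFour_transfer' [FiniteDimensional ℂ 𝔸] (parS₁ parS₂ : SiteParY 𝔸 i) (parB : BondParY 𝔸 i) (Gp₁ Gp₂ : SiteOpY 𝔸 i) (U : CfgY 𝔸 i)
    {B₀ κ : ℝ} (hB₀ : 0 ≤ B₀) (hκ : 0 ≤ κ) (hθ : 2 * (((d : ℝ) + 3) * B₀ * κ) ≤ 1)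
    (h₂ : IsUnit (deltaAY i parS₂ parB Gp₂ U))
    (hG0 : ∀ F, wNormBY i (-1) (GAY i parS₂ parB Gp₂ U F) ≤ B₀ * wNormBY i (-3) F)
    (hG1 : ∀ F ν, wNormBY i (-2) (cdB i U ν (GAY i parS₂ parB Gp₂ U F)) ≤ B₀ * wNormBY i (-3) F)
    (hG3 : ∀ F, wNormBY i (-3) (lapB i U (GAY i parS₂ parB Gp₂ U F)) ≤ B₀ * wNormBY i (-3) F)
    (hE : ∀ A, wNormBY i (-3) ((DPDsY i parS₂ Gp₂ U - DPDsY i parS₁ Gp₁ U) A) ≤ κ * wNormBY i (-1) A) :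
    IsUnit (deltaAY i parS₁ parB Gp₁ U) ∧
    (∀ F, wNormBY i (-1) (GAY i parS₁ parB Gp₁ U F) ≤ 2 * B₀ * wNormBY i (-3) F) ∧
    (∀ F ν, wNormBY i (-2) (cdB i U ν (GAY i parS₁ parB Gp₁ U F)) ≤ 2 * B₀ * wNormBY i (-3) F) ∧
    (∀ F, wNormBY i (-3) (lapB i U (GAY i parS₁ parB Gp₁ U F)) ≤ 2 * B₀ * wNormBY i (-3) F) := by
  refine deltaAFour_transfer i parS₁ parS₂ parB Gp₁ Gp₂ U hB₀ hκ hθ h₂ hG0 hG1 hG3 fun A => ?_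
  have h1 : wNormBY i (-3) (gradY i U ((RY i parS₁ Gp₁ U - RY i parS₂ Gp₂ U) (divY i U A))) =
      wNormBY i (-3) ((DPDsY i parS₂ Gp₂ U - DPDsY i parS₁ Gp₁ U) A) := by
    rw [← gradY_RY_sub_divY_eq]; rfl
  rw [h1]
  refine (hE A).trans (mul_le_mul_of_nonneg_left ?_ hκ)
  have h2 : 0 ≤ ∑ ν : Fin (d + 1), wNormBY i (-2) (cdB i U ν A) := Finset.sum_nonneg fun _ _ => wNormBY_nonneg i _ _
  linarith [wNormBY_nonneg i (-3) (lapB i U A)]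

end Letters

end Literature.MathematicalPhysics.QuantumFieldTheory.Balaban1983to89.B9B8KnitBondBootstrap

end
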